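import Summits.QuantumFields.YangMills.Theorems.BalabanUVNodesN08HaarCompatibilityGuardCoreLawSUNExplicit

/-!
# BalabanUVNodes ∕ N08 — (H_K-core), (H_K) AND PART 20's ONE-STEP BOUND AT THE [B10] SLOT FOR EVERY `N` WITH AN EXPLICIT CONSTANT
# `K = (1∕|Idx|)^{−(N²−1)} + 1 = (L^{d−1})^{N²−1} + 1` ON THE RANGE `|Idx| = L^{d−1} ≤ 300` (piece (v-c) of the general-`N` monotone height)

WIDTH SEAT `pub-ymgap-dag-n08-w6` g6 (R399 (3a); CLAIM-1 of record HOME INBOX l.38866), 2026-08-28.  Track A, DAG node N08 = [Balaban1985UV3] Thm 1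
p. 257 (compact) + Thm 2 p. 272; the typed (0.4) averaging and its guard = [Balaban1987RG1] (0.4) p. 253; key item K1⁷ `StabilityBAtRecordR13SepCoPH`
(stmt-QuantumFields-20542), `--supports … --as helper`.  COUNT-NEUTRAL.

THE POINT.  g5's `…GuardCoreLawSUN` §2 gives (H_K-core) ∕ (H_K) ∕ part 20's bound for every `N` and `L` with an EXISTENTIAL `K` (finite window cover); n08-w3's
31∕32 give a CLOSED number at `N = 2` on `L^{d−1} ≤ 400`.  With the injective law of `…GuardCoreLawSUNExplicit` (global injectivity of the printed fibre map for
every `N`, `Σcᵢ ≤ 1 − 1∕300`), the same three statements hold for EVERY `N` with the EXPLICIT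
  `K = (1∕|Idx|)^{−(N²−1)} + 1`   (`|Idx| = L^{d−1}` at the slot; the non-central weights are `1∕|Idx|`, `1 − Σcᵢ = nCentral∕|Idx| ≥ 1∕|Idx|`)
on the range `|Idx| ≤ 300` — ★★★ `core_law_le_explicit`, ★★ `fibre_law_le_explicit`, ★★★ `smul_map_avOfPrint_le_explicit` (part 24's `fibre_law_le_of_core` ∕
`smul_map_avOfPrint_le_of_core` BY IMPORT).

HONEST FRAMING.  Count-neutral helper (bookkeeping BY IMPORT); the RANGE `|Idx| ≤ 300` (every `L ≤ 17` at `d = 3`; every block size with an existential `K` stays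
g5's `…GuardCoreLawSUN`); ONE RG step at fixed ε on a finite torus — the k-UNIFORM `hmass` of the node's Theorem-1 letter is NOT supplied (stacking); E6′ NOT
decided; nothing of Bałaban's asserted; N08 NOT discharged; counts unmoved (typed 28∕28 · discharged 5∕27); R4 closes the CONDITIONAL rung `BalabanLadder.UV` only;
the Yang–Mills mass gap (Clay) is NOT proved by any of this; nothing continuum ∕ ℝ⁴ ∕ OS.  0 `sorry`, 0 `def`, 0 `instance`, 0 `notation`, standard axioms.
-/

noncomputable section

open NormedSpace Set Function Filter Topology MeasureTheory
open scoped ENNReal NNReal Matrix Matrix.Norms.L2Operator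

namespace Summit.QuantumFields.YangMills.BalabanUVNodes.N08HaarCompatibilityGuardCoreLawSUNExplicitSlot

open Literature.MathematicalPhysics.QuantumFieldTheory (haarProbability)
open Literature.MathematicalPhysics.QuantumFieldTheory.Balaban1983to89
open Literature.MathematicalPhysics.QuantumFieldTheory.Balaban1983to89.T4EMLTangentInjective (Kmat)
open Literature.MathematicalPhysics.QuantumFieldTheory.Balaban1983to89.ExpMeanLog (deltaSU lt_third_of_lt_deltaSU expMeanLogSU measurable_expMeanLogSU_E)
open Literature.MathematicalPhysics.QuantumFieldTheory.Balaban1983to89.BlockAveraging (Idx Small avgFun)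
open Literature.MathematicalPhysics.QuantumFieldTheory.Balaban1983to89.BlockAveragingHaarAC (IsCentral centralBond nCentral nCentral_pos)
open Summit.QuantumFields.YangMills.BalabanUVNodes.N08HaarCompatibilityGuardPowerMap (nCentral_le_card)
open Literature.MathematicalPhysics.QuantumFieldTheory.Balaban1985CMP102.Setting (Scales)
open Literature.MathematicalPhysics.QuantumFieldTheory.Balaban1983to89.B10RunsOfRecord (avOfPrint)
open Summit.QuantumFields.YangMills.BalabanUVNodes.N08HaarCompatibilityGuardCoreKmatDictionary (core_eq_kmat guard_of_core)
open Summit.QuantumFields.YangMills.BalabanUVNodes.N08HaarCompatibilityGuardFibreCore (measurable_core fibre_law_le_of_core smul_map_avOfPrint_le_of_core)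
open Summit.QuantumFields.YangMills.BalabanUVNodes.N08HaarCompatibilityGuardCoreLawSUN (isOpen_coreGuard sum_weights_lt_one)
open Summit.QuantumFields.YangMills.BalabanUVNodes.N08HaarCompatibilityGuardCoreLawSUNExplicit (map_haar_le_of_kmat_on_open)

variable {N : ℕ} [NeZero N] {P : Params} {j : ℕ}

/-- The weights of the core map: `Σ_{non-central} 1∕|Idx| = 1 − nCentral∕|Idx|`, so `1∕|Idx| ≤ 1 − Σ` and, on `|Idx| ≤ 300`, `Σ ≤ 1 − 1∕300`. [folklore] -/
theorem weights_core (c : PBond P (j + 1)) :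
    ((Fintype.card (Idx P) : ℝ))⁻¹ ≤ 1 - ∑ _i : {i : Idx P // ¬ IsCentral c i}, ((Fintype.card (Idx P) : ℝ))⁻¹ ∧
      (Fintype.card (Idx P) ≤ 300 → ∑ _i : {i : Idx P // ¬ IsCentral c i}, ((Fintype.card (Idx P) : ℝ))⁻¹ ≤ 1 - 1 / 300) := by
  classical
  have hcard : (0 : ℝ) < Fintype.card (Idx P) := Nat.cast_pos.mpr Fintype.card_pos
  have h1 : Fintype.card {i : Idx P // IsCentral c i} = nCentral c := by rw [nCentral, Fintype.card_subtype]
  have h2 := Fintype.card_subtype_compl (IsCentral c)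
  rw [h1] at h2
  have h3 := nCentral_pos c
  have h4 := nCentral_le_card c
  have hsum : ∑ _i : {i : Idx P // ¬ IsCentral c i}, ((Fintype.card (Idx P) : ℝ))⁻¹
      = 1 - (nCentral c : ℝ) / Fintype.card (Idx P) := by
    rw [Finset.sum_const, Finset.card_univ, nsmul_eq_mul, h2, Nat.cast_sub h4]
    field_simp
  rw [hsum]
  have h5 : (1 : ℝ) ≤ nCentral c := by exact_mod_cast h3
  constructor
  · rw [sub_sub_cancel, inv_eq_one_div]
    exact div_le_div_of_nonneg_right h5 hcard.le
  · intro hI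
    have hI' : (Fintype.card (Idx P) : ℝ) ≤ 300 := by exact_mod_cast hI
    have : (1 : ℝ) / 300 ≤ (nCentral c : ℝ) / Fintype.card (Idx P) := by
      rw [div_le_div_iff₀ (by norm_num) hcard]; nlinarith
    linarith

/-- ★★★ **(H_K-core) FOR EVERY `N` WITH THE EXPLICIT CONSTANT `(1∕|Idx|)^{−(N²−1)} + 1` on `|Idx| ≤ 300`**: for every coarse bond `c` and every frozen family
`V : Idx → SU(N)` whose core family meets the guard,  `Haar ∘ Φ_V⁻¹ ≤ ((1∕|Idx|)^{−(N²−1)} + 1)•Haar`  for the lattice-free core map `Φ_V` of part 24 — the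
hypothesis `hKc` of part 24's `fibre_law_le_of_core` ∕ `smul_map_avOfPrint_le_of_core` with a number. [cite: Balaban1987RG1, (0.4) p.253 (bookkeeping — the
bound is NOT in print)] -/
theorem core_law_le_explicit (hI : Fintype.card (Idx P) ≤ 300) (c : PBond P (j + 1)) (V : Idx P → Matrix.specialUnitaryGroup (Fin N) ℂ) :
    (∃ w : Matrix.specialUnitaryGroup (Fin N) ℂ, ∀ i : Idx P, dist1 (if IsCentral c i then (1 : Matrix.specialUnitaryGroup (Fin N) ℂ) else V i * w⁻¹) <
      (expMeanLogSU : LoopAverage (Matrix.specialUnitaryGroup (Fin N) ℂ)).δ) →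
    (HaarData.haar : Measure (Matrix.specialUnitaryGroup (Fin N) ℂ)).map (fun w : Matrix.specialUnitaryGroup (Fin N) ℂ =>
        (if ∀ i : Idx P, dist1 (if IsCentral c i then (1 : Matrix.specialUnitaryGroup (Fin N) ℂ) else V i * w⁻¹) <
            (expMeanLogSU : LoopAverage (Matrix.specialUnitaryGroup (Fin N) ℂ)).δ then
          (expMeanLogSU : LoopAverage (Matrix.specialUnitaryGroup (Fin N) ℂ)).avg
            (fun i : Idx P => if IsCentral c i then (1 : Matrix.specialUnitaryGroup (Fin N) ℂ) else V i * w⁻¹) else 1) * w) ≤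
      ((ENNReal.ofReal (((Fintype.card (Idx P) : ℝ))⁻¹ ^ (N ^ 2 - 1)))⁻¹ + 1) • (HaarData.haar : Measure (Matrix.specialUnitaryGroup (Fin N) ℂ)) := by
  classical
  intro _
  obtain ⟨hlow, hrange⟩ := weights_core c
  have hle := map_haar_le_of_kmat_on_open (N := N) (ι := {i : Idx P // ¬ IsCentral c i})
    (fun _ => ((Fintype.card (Idx P) : ℝ))⁻¹) (fun _ => inv_nonneg.2 (Nat.cast_nonneg _)) (hrange hI) (fun i => V i) _ _ (isOpen_coreGuard c V)
    (measurable_core (expMeanLogSU : LoopAverage (Matrix.specialUnitaryGroup (Fin N) ℂ)) measurable_expMeanLogSU_E c V)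
    (fun w hw i => guard_of_core c V w hw i) (fun w hw => ?_) (fun w hw => ?_)
  rotate_left
  · have hw' : ∀ i : Idx P, dist1 (if IsCentral c i then (1 : Matrix.specialUnitaryGroup (Fin N) ℂ) else V i * w⁻¹) <
        (expMeanLogSU : LoopAverage (Matrix.specialUnitaryGroup (Fin N) ℂ)).δ := hw
    rw [if_pos hw']; exact core_eq_kmat c V w hw'
  · have hw' : ¬ ∀ i : Idx P, dist1 (if IsCentral c i then (1 : Matrix.specialUnitaryGroup (Fin N) ℂ) else V i * w⁻¹) <
        (expMeanLogSU : LoopAverage (Matrix.specialUnitaryGroup (Fin N) ℂ)).δ := hw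
    rw [if_neg hw', one_mul]
  refine hle.trans (Measure.le_iff'.2 fun A => ?_)
  rw [Measure.smul_apply, Measure.smul_apply, smul_eq_mul, smul_eq_mul]
  refine mul_le_mul' ?_ le_rfl
  gcongr (?_)⁻¹ + 1
  exact ENNReal.ofReal_le_ofReal (pow_le_pow_left₀ (inv_nonneg.2 (Nat.cast_nonneg _)) hlow _)

/-- ★★ **(H_K) FOR EVERY `N` WITH THE EXPLICIT CONSTANT**: on `|Idx| ≤ 300`, every guard-admitting one-variable fibre law of the typed (0.4) averaging with the
printed `SU(N)` average is `≤ ((1∕|Idx|)^{−(N²−1)} + 1)•Haar` (part 24's `fibre_law_le_of_core`). [cite: Balaban1987RG1, (0.4) p.253 (bookkeeping)] -/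
theorem fibre_law_le_explicit (hI : Fintype.card (Idx P) ≤ 300) (hj : j + 1 ≤ P.m + P.K) :
    ∀ (c : PBond P (j + 1)) (U : GaugeField P j (Matrix.specialUnitaryGroup (Fin N) ℂ)),
      (∃ g : Matrix.specialUnitaryGroup (Fin N) ℂ, Small (expMeanLogSU : LoopAverage (Matrix.specialUnitaryGroup (Fin N) ℂ)) (update U (centralBond c) g) c) →
      (HaarData.haar : Measure (Matrix.specialUnitaryGroup (Fin N) ℂ)).map
          (fun g => avgFun (expMeanLogSU : LoopAverage (Matrix.specialUnitaryGroup (Fin N) ℂ)) (update U (centralBond c) g) c) ≤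
        ((ENNReal.ofReal (((Fintype.card (Idx P) : ℝ))⁻¹ ^ (N ^ 2 - 1)))⁻¹ + 1) • (HaarData.haar : Measure (Matrix.specialUnitaryGroup (Fin N) ℂ)) :=
  fibre_law_le_of_core (expMeanLogSU : LoopAverage (Matrix.specialUnitaryGroup (Fin N) ℂ)) hj measurable_expMeanLogSU_E (core_law_le_explicit hI)

/-- ★★★ **PART 20's ONE-STEP EXTENSIVE TRANSPORT BOUND AT THE [B10] SLOT FOR EVERY `N` WITH AN EXPLICIT CONSTANT**: for the [B10] run of print on `SU(N)`, every
in-range level `j`, every `δ′`, on `|Idx| ≤ 300`:  `h(δ′)^n • (avOfPrint N S₀ j)_*(dU) ≤ (h(δ′) + (K − 1)·h(δ_N + δ′)^{L^{d−1}−1})^n • dV`, `n = #PBond(j+1)`,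
`δ_N = min(1∕3, π∕N)`, **`K = (1∕|Idx|)^{−(N²−1)} + 1`** — part 24's `smul_map_avOfPrint_le_of_core` fed with `core_law_le_explicit`.  HONEST: range `|Idx| ≤ 300`;
ONE RG step; the k-uniform `hmass` is NOT supplied; the Yang–Mills mass gap is NOT proved. [cite: Balaban1985UV3, (2) p.256; Balaban1987RG1, (0.4) p.253 (bookkeeping)] -/
theorem smul_map_avOfPrint_le_explicit {L : ℕ} (S₀ : Scales L) (hI : Fintype.card (Idx S₀.P) ≤ 300) {j : ℕ} (hj : j + 1 ≤ S₀.P.m + S₀.P.K) (δ' : ℝ) :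
    (HaarData.haar : Measure (Matrix.specialUnitaryGroup (Fin N) ℂ)) {g : Matrix.specialUnitaryGroup (Fin N) ℂ | dist1 g < δ'} ^ Fintype.card (PBond S₀.P (j + 1)) •
        (fieldMeasure S₀.P j (Matrix.specialUnitaryGroup (Fin N) ℂ)).map (avOfPrint N S₀ j).avg ≤
      ((HaarData.haar : Measure (Matrix.specialUnitaryGroup (Fin N) ℂ)) {g : Matrix.specialUnitaryGroup (Fin N) ℂ | dist1 g < δ'} +
          (((ENNReal.ofReal (((Fintype.card (Idx S₀.P) : ℝ))⁻¹ ^ (N ^ 2 - 1)))⁻¹ + 1) - 1) *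
            (HaarData.haar : Measure (Matrix.specialUnitaryGroup (Fin N) ℂ))
              {g : Matrix.specialUnitaryGroup (Fin N) ℂ | dist1 g < min (1 / 3) (Real.pi / N) + δ'} ^ (S₀.P.L ^ (S₀.P.d - 1) - 1)) ^
          Fintype.card (PBond S₀.P (j + 1)) •
        fieldMeasure S₀.P (j + 1) (Matrix.specialUnitaryGroup (Fin N) ℂ) := by
  have hcard : (0 : ℝ) < Fintype.card (Idx S₀.P) := Nat.cast_pos.mpr Fintype.card_pos
  have hKt : (ENNReal.ofReal (((Fintype.card (Idx S₀.P) : ℝ))⁻¹ ^ (N ^ 2 - 1)))⁻¹ + 1 ≠ ∞ :=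
    ENNReal.add_ne_top.2 ⟨ENNReal.inv_ne_top.2 (ENNReal.ofReal_pos.2 (pow_pos (inv_pos.2 hcard) _)).ne', ENNReal.one_ne_top⟩
  exact smul_map_avOfPrint_le_of_core N S₀ hj le_add_self hKt (core_law_le_explicit hI) δ'

end Summit.QuantumFields.YangMills.BalabanUVNodes.N08HaarCompatibilityGuardCoreLawSUNExplicitSlot
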